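import Mathlib
import HarnessLib
import Summits.NavierStokesRegularity.NavierStokesRegularity.Theorems.PoloidalWindowDoorLrcModEntireRidgeGlobalBranchUnique
import Summits.NavierStokesRegularity.NavierStokesRegularity.Theorems.PoloidalWindowDoorLrcModEntirePlanarCurveRigidity

/-!
# Route `PoloidalWindowDoor`, item `LrcModEntire` (stmt-NavierStokesRegularity-20428), cells (Q4-curved)/(Q4-sonic, curved) of the (TH) column —
# THE FERMI FACTOR ON A UNIFORM HEIGHT WINDOW (class-free tools): curvature bound of a hot branch, uniform smallness of the web function

Cell ns-regularity-ideate, stub-worker seat ns-poloidal-K2-p2 g16 under the LEAD of item 20428 (ns-poloidal-K2-p3 g16);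
`--supports stmt-NavierStokesRegularity-20428 --as helper`.  Memo `Cruxes/LrcModEntire/T2B-g16-sonic.md` §3/§5.  The weighted Grönwall step
`…CurvedParallelWebs.webFun_eq_of_curved_huygens` needs the Fermi factor `J = 1 − k(s)G(s,z)` non-zero on a region `ℝ × (−δ₂, δ₂)` UNIFORMLY in `s`; two
class-free estimates give it:

* `norm_deriv_deriv_le_of_hotCurve` — CURVATURE BOUND: a `C²` unit-speed hot curve `γ` of an analytic `f` with `‖D²f‖ ≤ C₂`, `‖D³f‖ ≤ C₃`, critical non-degenerate
  (`κ ≠ 0`) hot set solves the hot-branch ODE (LEAD g15 `…RidgeGlobalBranchUnique.hasDerivAt_goodCurve`), so `‖γ″‖ ≤ κ⁻²·4C₃C₂` (`…RidgeGlobalBranchODE.norm_accel_le`);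
  with Frenet (`…PlanarCurveRigidity`) the signed curvature obeys `|k| ≤ κ⁻²·4C₃C₂` (`abs_curvature_le_of_hotCurve`);
* `abs_critical_lt_of_concave` — UNIFORM SMALLNESS OF THE WEB FUNCTION: for `F₀ ∈ C³` with `‖D²F₀‖ ≤ C₂`, `‖D³F₀‖ ≤ C₃`, a point `x₀` with `∂_νF₀(x₀) = 0`,
  `D²F₀(x₀)[ν,ν] = −κ'` (`κ' > 0`, `‖ν‖ = 1`, `‖e‖ ≤ 1`), a cross-section `n ↦ F₀(x₀ + nν + z e)` strictly concave on `(−r, r)` and a critical point `G ∈ (−r,r)` of it: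
  `|G| < ρ₀` as soon as `C₃(ρ₀ + |z|) ≤ κ'/2` and `C₂|z| < κ'ρ₀/2` (two mean-value steps) — with `x₀ = Γ s`, `ν = JΓ′ s`, `e = e₂` this bounds the web function of the
  curved web package uniformly in `s`.

WHAT THIS IS NOT: not a claim about Navier–Stokes regularity — calculus for the hypothetical web of research cell (Q4); items 20428 / 19708 / 27893 OPEN.
-/

noncomputable section

-- the summit and its single sub-problem share the name (CONVENTIONS §1), as in every Theorems file
set_option linter.dupNamespace false

namespace Summit.NavierStokesRegularity.NavierStokesRegularity.Theorems.PoloidalWindowDoorLrcModEntireCurvedWebWindow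

open Set Function Filter Topology Metric
open scoped InnerProductSpace RealInnerProductSpace ContDiff
open Summit.NavierStokesRegularity.NavierStokesRegularity.Theorems.PoloidalWindowDoorLrcModEntireRidgeGlobalBranchODE
open Summit.NavierStokesRegularity.NavierStokesRegularity.Theorems.PoloidalWindowDoorLrcModEntireRidgeGlobalBranchFrame
open Summit.NavierStokesRegularity.NavierStokesRegularity.Theorems.PoloidalWindowDoorLrcModEntireRidgeGlobalBranchUnique
open Summit.NavierStokesRegularity.NavierStokesRegularity.Theorems.PoloidalWindowDoorLrcModEntirePlanarCurveRigidity

/-! ### A. Curvature bound of a hot branch -/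

section curvature

variable {f : EuclideanSpace ℝ (Fin 3) → ℝ} {κ M C₂ C₃ : ℝ}

/-- **The acceleration of a hot branch is bounded**: `‖γ″ s‖ ≤ κ⁻²·4C₃C₂` (hot-branch ODE + `norm_accel_le`). -/
theorem norm_deriv_deriv_le_of_hotCurve (hfa : AnalyticOnNhd ℝ f univ)
    (hC₂ : ∀ x, ‖iteratedFDeriv ℝ 2 f x‖ ≤ C₂) (hC₃ : ∀ x, ‖iteratedFDeriv ℝ 3 f x‖ ≤ C₃) (hκ : κ ≠ 0)
    (hcrit : ∀ y : EuclideanSpace ℝ (Fin 3), y 2 = 0 → f y = M → fderiv ℝ f y = 0)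
    (htr : ∀ y : EuclideanSpace ℝ (Fin 3), y 2 = 0 → f y = M → fderiv ℝ (fderiv ℝ f) y e0 e0 + fderiv ℝ (fderiv ℝ f) y e1 e1 = -κ)
    {γ : ℝ → EuclideanSpace ℝ (Fin 3)} (hγ2 : ContDiff ℝ 2 γ) (hplane : ∀ s, γ s 2 = 0) (hhot : ∀ s, f (γ s) = M)
    (hunit : ∀ s, ‖deriv γ s‖ = 1) (s : ℝ) :
    ‖deriv (deriv γ) s‖ ≤ κ⁻¹ ^ 2 * (4 * (C₃ * C₂)) := by
  have hZ := hasDerivAt_goodCurve hfa hκ hcrit htr hγ2 hplane hhot hunit s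
  have h2 : HasDerivAt (fun t => deriv γ t) (accel f κ (γ s, deriv γ s)) s :=
    (ContinuousLinearMap.snd ℝ (EuclideanSpace ℝ (Fin 3)) (EuclideanSpace ℝ (Fin 3))).hasFDerivAt.comp_hasDerivAt s hZ
  rw [h2.deriv]
  exact norm_accel_le hC₂ hC₃ _

/-- **Curvature bound**: with the Frenet law `γ″ = k•Jγ′`, `|k s| ≤ κ⁻²·4C₃C₂`. -/
theorem abs_curvature_le_of_hotCurve (hfa : AnalyticOnNhd ℝ f univ)
    (hC₂ : ∀ x, ‖iteratedFDeriv ℝ 2 f x‖ ≤ C₂) (hC₃ : ∀ x, ‖iteratedFDeriv ℝ 3 f x‖ ≤ C₃) (hκ : κ ≠ 0)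
    (hcrit : ∀ y : EuclideanSpace ℝ (Fin 3), y 2 = 0 → f y = M → fderiv ℝ f y = 0)
    (htr : ∀ y : EuclideanSpace ℝ (Fin 3), y 2 = 0 → f y = M → fderiv ℝ (fderiv ℝ f) y e0 e0 + fderiv ℝ (fderiv ℝ f) y e1 e1 = -κ)
    {γ : ℝ → EuclideanSpace ℝ (Fin 3)} (hγ2 : ContDiff ℝ 2 γ) (hplane : ∀ s, γ s 2 = 0) (hhot : ∀ s, f (γ s) = M)
    (hunit : ∀ s, ‖deriv γ s‖ = 1) {k : ℝ → ℝ} (hk : ∀ s, deriv (deriv γ) s = k s • rotJ (deriv γ s)) (s : ℝ) :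
    |k s| ≤ κ⁻¹ ^ 2 * (4 * (C₃ * C₂)) := by
  have h := norm_deriv_deriv_le_of_hotCurve hfa hC₂ hC₃ hκ hcrit htr hγ2 hplane hhot hunit s
  have hT2 : deriv γ s 2 = 0 := (deriv_horizontal hγ2 hplane s).1
  rw [hk s, norm_smul, (rotJ_facts hT2 (hunit s)).2.1, mul_one, Real.norm_eq_abs] at h
  exact h

end curvature

/-! ### B. Uniform smallness of the critical point of a strictly concave cross-section -/

section smallness

variable {F₀ : EuclideanSpace ℝ (Fin 3) → ℝ} {C₂ C₃ : ℝ}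

/-- First derivatives are `C₂`-Lipschitz: `|DF₀(x)[ν] − DF₀(y)[ν]| ≤ C₂‖x − y‖` for `‖ν‖ ≤ 1`. -/
theorem abs_fderiv_sub_le (hF : ContDiff ℝ 2 F₀) (hC₂ : ∀ x, ‖iteratedFDeriv ℝ 2 F₀ x‖ ≤ C₂) {ν : EuclideanSpace ℝ (Fin 3)} (hν : ‖ν‖ ≤ 1)
    (x y : EuclideanSpace ℝ (Fin 3)) : |fderiv ℝ F₀ x ν - fderiv ℝ F₀ y ν| ≤ C₂ * ‖x - y‖ := by
  have hmv := norm_iteratedFDeriv_sub_le (k := 1) hF hC₂ x y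
  have h := (iteratedFDeriv ℝ 1 F₀ x - iteratedFDeriv ℝ 1 F₀ y).le_opNorm ![ν]
  rw [Fin.prod_univ_one] at h
  simp only [sub_apply, iteratedFDeriv_one_apply, Matrix.cons_val_fin_one] at h
  have hC0 : 0 ≤ C₂ := (norm_nonneg _).trans (hC₂ x)
  rw [← Real.norm_eq_abs]
  calc ‖fderiv ℝ F₀ x ν - fderiv ℝ F₀ y ν‖ ≤ ‖iteratedFDeriv ℝ 1 F₀ x - iteratedFDeriv ℝ 1 F₀ y‖ * ‖ν‖ := h
    _ ≤ C₂ * ‖x - y‖ * 1 := mul_le_mul hmv hν (norm_nonneg _) (by positivity)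
    _ = C₂ * ‖x - y‖ := by ring

/-- Second derivatives are `C₃`-Lipschitz: `|D²F₀(x)[ν,ν] − D²F₀(y)[ν,ν]| ≤ C₃‖x − y‖` for `‖ν‖ ≤ 1`. -/
theorem abs_fderiv_fderiv_sub_le (hF : ContDiff ℝ 3 F₀) (hC₃ : ∀ x, ‖iteratedFDeriv ℝ 3 F₀ x‖ ≤ C₃) {ν : EuclideanSpace ℝ (Fin 3)} (hν : ‖ν‖ ≤ 1)
    (x y : EuclideanSpace ℝ (Fin 3)) : |fderiv ℝ (fderiv ℝ F₀) x ν ν - fderiv ℝ (fderiv ℝ F₀) y ν ν| ≤ C₃ * ‖x - y‖ := by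
  have h := dist_D2c_le hF hC₃ hν hν x y
  rw [Real.dist_eq, dist_eq_norm] at h
  rw [fderiv_fderiv_eq_D2c, fderiv_fderiv_eq_D2c]
  exact h

/-- ★ **UNIFORM SMALLNESS OF THE CRITICAL POINT.**  `F₀ ∈ C³`, `‖D²F₀‖ ≤ C₂`, `‖D³F₀‖ ≤ C₃`; `‖ν‖ = 1`, `‖e‖ ≤ 1`; at `x₀`: `DF₀(x₀)[ν] = 0` and
`D²F₀(x₀)[ν,ν] = −κ'` with `κ' > 0`; the cross-section `n ↦ F₀(x₀ + nν + z e)` has `D²F₀[ν,ν] < 0` along `n ∈ (−r,r)`, and `G ∈ (−r, r)` is a critical point of it.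
If `C₃(ρ₀ + |z|) ≤ κ'/2` and `C₂|z| < κ'ρ₀/2` (`ρ₀ > 0`) then `|G| < ρ₀`. -/
theorem abs_critical_lt_of_concave (hF : ContDiff ℝ 3 F₀) (hC₂ : ∀ x, ‖iteratedFDeriv ℝ 2 F₀ x‖ ≤ C₂) (hC₃ : ∀ x, ‖iteratedFDeriv ℝ 3 F₀ x‖ ≤ C₃)
    {ν e x₀ : EuclideanSpace ℝ (Fin 3)} (hν : ‖ν‖ = 1) (he : ‖e‖ ≤ 1) {κ' z r G ρ₀ : ℝ} (hρ₀ : 0 < ρ₀)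
    (hcrit0 : fderiv ℝ F₀ x₀ ν = 0) (hcurv0 : fderiv ℝ (fderiv ℝ F₀) x₀ ν ν = -κ')
    (hconc : ∀ n ∈ Ioo (-r) r, fderiv ℝ (fderiv ℝ F₀) (x₀ + n • ν + z • e) ν ν < 0)
    (hG : G ∈ Ioo (-r) r) (hGcrit : fderiv ℝ F₀ (x₀ + G • ν + z • e) ν = 0)
    (h1 : C₃ * (ρ₀ + |z|) ≤ κ' / 2) (h2 : C₂ * |z| < κ' * ρ₀ / 2) : |G| < ρ₀ := by
  have hF2 : ContDiff ℝ 2 F₀ := hF.of_le (by norm_num)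
  have hFd : Differentiable ℝ F₀ := hF2.differentiable (by norm_num)
  have hDF : ∀ y, HasFDerivAt (fderiv ℝ F₀) (fderiv ℝ (fderiv ℝ F₀) y) y := fun y =>
    (((hF2.fderiv_right (m := 1) (by norm_num)).differentiable one_ne_zero) y).hasFDerivAt
  -- the slope of the cross-section: `φ n = DF₀(x₀ + nν + ze)[ν]`, with `φ′ n = D²F₀(…)[ν,ν]`
  set φ : ℝ → ℝ := fun n => fderiv ℝ F₀ (x₀ + n • ν + z • e) ν with hφ
  set φ' : ℝ → ℝ := fun n => fderiv ℝ (fderiv ℝ F₀) (x₀ + n • ν + z • e) ν ν with hφ'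
  have hφd : ∀ n, HasDerivAt φ (φ' n) n := by
    intro n
    have hline : HasDerivAt (fun m : ℝ => x₀ + m • ν + z • e) ν n := by
      have h := (((hasDerivAt_id n).smul_const ν).const_add x₀).add_const (z • e)
      simpa using h
    have hc : HasDerivAt (fun m : ℝ => fderiv ℝ F₀ (x₀ + m • ν + z • e)) (fderiv ℝ (fderiv ℝ F₀) (x₀ + n • ν + z • e) ν) n :=
      (hDF _).comp_hasDerivAt n hline
    exact (hc.clm_apply (hasDerivAt_const n ν)).congr_deriv (by simp [hφ'])
  -- `|φ 0| ≤ C₂|z|` and `φ′ ≤ −κ'/2` on `|n| ≤ ρ₀`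
  have hνle : ‖ν‖ ≤ 1 := hν.le
  have hφ0 : |φ 0| ≤ C₂ * |z| := by
    have h := abs_fderiv_sub_le hF2 hC₂ hνle (x₀ + (0 : ℝ) • ν + z • e) x₀
    rw [hcrit0, sub_zero] at h
    refine h.trans ?_
    have : ‖x₀ + (0 : ℝ) • ν + z • e - x₀‖ ≤ |z| := by
      rw [zero_smul, add_zero, add_sub_cancel_left, norm_smul, Real.norm_eq_abs]
      calc |z| * ‖e‖ ≤ |z| * 1 := mul_le_mul_of_nonneg_left he (abs_nonneg _)
        _ = |z| := mul_one _
    have hC0 : 0 ≤ C₂ := (norm_nonneg _).trans (hC₂ x₀)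
    exact mul_le_mul_of_nonneg_left this hC0
  have hφ'le : ∀ n, |n| ≤ ρ₀ → φ' n ≤ -(κ' / 2) := by
    intro n hn
    have h := abs_fderiv_fderiv_sub_le hF hC₃ hνle (x₀ + n • ν + z • e) x₀
    rw [hcurv0] at h
    have hdist : ‖x₀ + n • ν + z • e - x₀‖ ≤ |n| + |z| := by
      rw [add_assoc, add_sub_cancel_left]
      refine (norm_add_le _ _).trans ?_
      rw [norm_smul, norm_smul, Real.norm_eq_abs, Real.norm_eq_abs, hν, mul_one]
      have : |z| * ‖e‖ ≤ |z| := by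
        calc |z| * ‖e‖ ≤ |z| * 1 := mul_le_mul_of_nonneg_left he (abs_nonneg _)
          _ = |z| := mul_one _
      linarith
    have hC0 : 0 ≤ C₃ := (norm_nonneg _).trans (hC₃ x₀)
    have h' : |φ' n - -κ'| ≤ C₃ * (ρ₀ + |z|) :=
      h.trans ((mul_le_mul_of_nonneg_left hdist hC0).trans (mul_le_mul_of_nonneg_left (by linarith) hC0))
    have := (abs_le.1 h').2
    linarith
  -- `φ` is strictly decreasing on `(−r, r)`
  have hφanti : ∀ a b, a ∈ Ioo (-r) r → b ∈ Ioo (-r) r → a < b → φ b < φ a := by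
    intro a b ha hb hab
    obtain ⟨ξ, hξ, hslope⟩ := exists_hasDerivAt_eq_slope φ φ' hab (fun n _ => (hφd n).continuousAt.continuousWithinAt)
      (fun n _ => hφd n)
    have hξI : ξ ∈ Ioo (-r) r := ⟨lt_trans ha.1 hξ.1, lt_trans hξ.2 hb.2⟩
    have hneg : φ' ξ < 0 := hconc ξ hξI
    rw [hslope] at hneg
    have := (div_neg_iff.1 hneg)
    rcases this with ⟨h1', _⟩ | ⟨_, h2'⟩
    · linarith
    · linarith
  -- mean value on `[0, ρ₀]` and on `[−ρ₀, 0]`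
  have hup : ρ₀ < r → φ ρ₀ ≤ φ 0 - κ' / 2 * ρ₀ := by
    intro hρr
    obtain ⟨ξ, hξ, hslope⟩ := exists_hasDerivAt_eq_slope φ φ' hρ₀ (fun n _ => (hφd n).continuousAt.continuousWithinAt)
      (fun n _ => hφd n)
    have hξle : |ξ| ≤ ρ₀ := abs_le.2 ⟨by linarith [hξ.1], hξ.2.le⟩
    have h := hφ'le ξ hξle
    rw [hslope, div_le_iff₀ (by linarith)] at h
    linarith
  have hdown : ρ₀ < r → φ 0 + κ' / 2 * ρ₀ ≤ φ (-ρ₀) := by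
    intro hρr
    obtain ⟨ξ, hξ, hslope⟩ := exists_hasDerivAt_eq_slope φ φ' (by linarith : -ρ₀ < 0)
      (fun n _ => (hφd n).continuousAt.continuousWithinAt) (fun n _ => hφd n)
    have hξle : |ξ| ≤ ρ₀ := abs_le.2 ⟨hξ.1.le, by linarith [hξ.2]⟩
    have h := hφ'le ξ hξle
    rw [hslope, div_le_iff₀ (by linarith)] at h
    linarith
  have hGφ : φ G = 0 := hGcrit
  -- conclude
  by_contra hcon
  rw [not_lt] at hcon
  have hρr : ρ₀ < r := lt_of_le_of_lt hcon (abs_lt.2 hG)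
  have hz2 : C₂ * |z| < κ' / 2 * ρ₀ := by linarith
  rcases le_or_gt 0 G with hG0 | hG0
  · -- `G ≥ ρ₀`
    have hGρ : ρ₀ ≤ G := by rwa [abs_of_nonneg hG0] at hcon
    have hle : φ G ≤ φ ρ₀ := by
      rcases hGρ.lt_or_eq with hlt | heq
      · exact (hφanti ρ₀ G ⟨by linarith, hρr⟩ hG hlt).le
      · rw [heq]
    have := hup hρr
    have h0 := (abs_le.1 hφ0).2
    linarith
  · -- `G ≤ −ρ₀`
    have hGρ : G ≤ -ρ₀ := by rw [abs_of_neg hG0] at hcon; linarith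
    have hle : φ (-ρ₀) ≤ φ G := by
      rcases hGρ.lt_or_eq with hlt | heq
      · exact (hφanti G (-ρ₀) hG ⟨by linarith, by linarith⟩ hlt).le
      · rw [heq]
    have := hdown hρr
    have h0 := (abs_le.1 hφ0).1
    linarith

end smallness

end Summit.NavierStokesRegularity.NavierStokesRegularity.Theorems.PoloidalWindowDoorLrcModEntireCurvedWebWindow
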